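import Mathlib.Geometry.Manifold.ChartedSpace
import Mathlib.Analysis.InnerProductSpace.PiL2
import Summits.Ventures.HodgeRepro2.HostAPI.Carriers.AlgebraicTopology.SingularHomology.Orientation
import Summits.Ventures.HodgeRepro2.HostAPI.Util.ForallBinderLint
open HostAPI.Carriers

noncomputable section

open CategoryTheory Limits Topology

universe u v

namespace HostAPI.Carriers.AlgebraicTopology.SingularHomology

variable (R : Type v) [CommRing R] (M : Type v) [AddCommGroup M] [Module R M]
variable {X Y Z : Type u} [TopologicalSpace X] [TopologicalSpace Y] [TopologicalSpace Z]

namespace singularHomology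

variable (X) in

def toLocalOfSet (K : Set X) (n : ℕ) : singularHomology R M X n ⟶ localHomologyOfSet R M X K n :=
  relativeSingularHomology.ofAbsolute R M X Kᶜ n

def toLocal (x : X) (n : ℕ) : singularHomology R M X n ⟶ localHomology R M X x n :=
  toLocalOfSet R M X {x} n

lemma toLocal_eq_toLocalOfSet (x : X) (n : ℕ) : toLocal R M x n = toLocalOfSet R M X {x} n := rfl

@[reassoc (attr := simp)]
lemma toLocalOfSet_comp_restrictLocal {K L : Set X} (h : L ⊆ K) (n : ℕ) :
    toLocalOfSet R M X K n ≫ restrictLocal R M h n = toLocalOfSet R M X L n := by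
  rw [toLocalOfSet, restrictLocal, relativeSingularHomology.ofAbsolute_comp_map,
    singularHomology.map_id, Category.id_comp]
  rfl

@[simp]
lemma restrictLocal_toLocalOfSet {K L : Set X} (h : L ⊆ K) (n : ℕ) (c : singularHomology R M X n) :
    restrictLocal R M h n (toLocalOfSet R M X K n c) = toLocalOfSet R M X L n c := by
  rw [← ModuleCat.comp_apply, toLocalOfSet_comp_restrictLocal]

lemma restrictToPoint_toLocalOfSet {K : Set X} {x : X} (hx : x ∈ K) (n : ℕ)
    (c : singularHomology R M X n) :
    restrictToPoint R M hx n (toLocalOfSet R M X K n c) = toLocal R M x n c :=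
  restrictLocal_toLocalOfSet R M _ n c

@[reassoc]
lemma toLocal_comp_mapIso_hom (e : X ≃ₜ Y) (x : X) (n : ℕ) :
    toLocal R M x n ≫ (localHomology.mapIso R M e x n).hom =
      singularHomology.map R M (e : C(X, Y)) n ≫ toLocal R M (e x) n :=
  relativeSingularHomology.ofAbsolute_comp_map R M _ _ n

end singularHomology

variable {R} {n : ℕ}

def IsFundamentalClass (μ : HomologicalOrientation R X n) (c : singularHomology R R X n) : Prop :=
  ∀ x : X, singularHomology.toLocal R R x n c = μ.localClass x

lemma IsFundamentalClass.neg {μ : HomologicalOrientation R X n} {c : singularHomology R R X n}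
    (h : IsFundamentalClass μ c) : IsFundamentalClass (-μ) (-c) := fun x ↦ by
  rw [map_neg, h x, HomologicalOrientation.neg_localClass]

lemma isFundamentalClass_comap_iff (μ : HomologicalOrientation R X n) (e : Y ≃ₜ X)
    (c' : singularHomology R R Y n) :
    IsFundamentalClass (μ.comap e) c' ↔
      IsFundamentalClass μ (singularHomology.map R R (e : C(Y, X)) n c') := by
  rw [IsFundamentalClass, IsFundamentalClass, e.surjective.forall]
  refine forall_congr' fun y ↦ ?_
  rw [HomologicalOrientation.comap_localClass, ← ModuleCat.comp_apply,
    ← singularHomology.toLocal_comp_mapIso_hom, ModuleCat.comp_apply]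
  constructor
  · intro h
    rw [h, ← ModuleCat.comp_apply, Iso.inv_hom_id, ModuleCat.id_apply]
  · intro h
    rw [← (localHomology.mapIso R R e y n).toLinearEquiv.injective.eq_iff,
      Iso.toLinearEquiv_apply, Iso.toLinearEquiv_apply, h, ← ModuleCat.comp_apply,
      Iso.inv_hom_id, ModuleCat.id_apply]

def existsUnique_isFundamentalClass : Prop :=
  ∀ [CompactSpace X] [T2Space X] [ChartedSpace (EuclideanSpace ℝ (Fin n)) X] (μ : HomologicalOrientation R X n),
    ∃! c : singularHomology R R X n, IsFundamentalClass μ c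

def IsFundamentalClass.unique : Prop :=
  ∀ [CompactSpace X] [T2Space X] [ChartedSpace (EuclideanSpace ℝ (Fin n)) X] {μ : HomologicalOrientation R X n} {c c' : singularHomology R R X n} (hc : IsFundamentalClass μ c) (hc' : IsFundamentalClass μ c'),
    c = c'

variable (R) in

def isZero_singularHomology_of_lt : Prop :=
  ∀ [CompactSpace X] [T2Space X] [ChartedSpace (EuclideanSpace ℝ (Fin n)) X] {k : ℕ} (hk : n < k),
    IsZero (singularHomology R M X k)

variable (R) in

def singularHomology.toLocal_injective_of_connectedSpace : Prop :=
  ∀ [CompactSpace X] [T2Space X] [ChartedSpace (EuclideanSpace ℝ (Fin n)) X] [ConnectedSpace X] (x : X),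
    Function.Injective (singularHomology.toLocal R M x n)

def nonempty_singularHomology_top_iso : Prop :=
  ∀ [CompactSpace X] [T2Space X] [ChartedSpace (EuclideanSpace ℝ (Fin n)) X] [ConnectedSpace X] (μ : HomologicalOrientation R X n),
    Nonempty (singularHomology R R X n ≅ ModuleCat.of R (ULift.{u} R))

def isZero_singularHomology_top_of_not_isOrientableOver_int : Prop :=
  ∀ [CompactSpace X] [T2Space X] [ChartedSpace (EuclideanSpace ℝ (Fin n)) X] [ConnectedSpace X] (h : ¬ IsOrientableOver ℤ X n),
    IsZero (singularHomology ℤ ℤ X n)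

namespace HomologicalOrientation

open Classical in

def fundamentalClass (μ : HomologicalOrientation R X n) : singularHomology R R X n :=
  if h : ∃ c, IsFundamentalClass μ c then h.choose else 0

lemma isFundamentalClass_fundamentalClass_of_exists {μ : HomologicalOrientation R X n}
    (h : ∃ c, IsFundamentalClass μ c) : IsFundamentalClass μ μ.fundamentalClass := by
  rw [fundamentalClass, dif_pos h]
  exact h.choose_spec

lemma fundamentalClass_of_not_exists {μ : HomologicalOrientation R X n}
    (h : ¬ ∃ c, IsFundamentalClass μ c) : μ.fundamentalClass = 0 := by
  rw [fundamentalClass, dif_neg h]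

def isFundamentalClass_fundamentalClass : Prop :=
  ∀ [CompactSpace X] [T2Space X] [ChartedSpace (EuclideanSpace ℝ (Fin n)) X] (μ : HomologicalOrientation R X n),
    IsFundamentalClass μ μ.fundamentalClass

def _root_.HostAPI.Carriers.AlgebraicTopology.SingularHomology.IsFundamentalClass.fundamentalClass_eq : Prop :=
  ∀ [CompactSpace X] [T2Space X] [ChartedSpace (EuclideanSpace ℝ (Fin n)) X] {μ : HomologicalOrientation R X n} {c : singularHomology R R X n} (hc : IsFundamentalClass μ c),
    μ.fundamentalClass = c

def fundamentalClass_neg : Prop :=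
  ∀ [CompactSpace X] [T2Space X] [ChartedSpace (EuclideanSpace ℝ (Fin n)) X] (μ : HomologicalOrientation R X n),
    (-μ).fundamentalClass = -μ.fundamentalClass

def fundamentalClass_comap : Prop :=
  ∀ [CompactSpace X] [T2Space X] [ChartedSpace (EuclideanSpace ℝ (Fin n)) X] (μ : HomologicalOrientation R X n) (e : Y ≃ₜ X),
    (μ.comap e).fundamentalClass = (singularHomology.mapIso R R e n).inv μ.fundamentalClass

end HomologicalOrientation

def HasDegree (μ : HomologicalOrientation R X n) (ν : HomologicalOrientation R Y n) (f : C(X, Y))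
    (d : ℤ) : Prop :=
  singularHomology.map R R f n μ.fundamentalClass = d • ν.fundamentalClass

theorem hasDegree_one_id (μ : HomologicalOrientation R X n) : HasDegree μ μ (ContinuousMap.id X) 1 := by
  rw [HasDegree, singularHomology.map_id, ModuleCat.id_apply, one_zsmul]

theorem HasDegree.comp {μ : HomologicalOrientation R X n} {ν : HomologicalOrientation R Y n}
    {ξ : HomologicalOrientation R Z n} {f : C(X, Y)} {g : C(Y, Z)} {d d' : ℤ}
    (hf : HasDegree μ ν f d) (hg : HasDegree ν ξ g d') : HasDegree μ ξ (g.comp f) (d' * d) := by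
  rw [HasDegree, singularHomology.map_comp, ModuleCat.comp_apply, hf, map_zsmul, hg, smul_smul,
    mul_comm]

end HostAPI.Carriers.AlgebraicTopology.SingularHomology
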